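import Summits.AtomisticToContinuum.Crystallization.Theorems.FrustratedLawDichotomyStrainedPatchWindowFamilies

/-!
(SPLIT FOR THE 400-LINE CAP by the landing lane, hand-2 g29: this file = part A (§0 tube form / pure cover / junction, §1 bond charts, cell lemma, host net); part B = `…StrainedPatchHostCells` (§2 pins and record) imports it; same namespace, all FQNs unchanged.)
# Host cells: the augmented-envelope line PINNED, in tube form, with its finite host net («HostCells», lens-5 g61)

Lens-5 («finite / base range + asymptotic regime + bridge») node under g60 «AugmentedEnvelope» (line 60A) on the 27623 T-side piece
`StrainedPatchRec`.  TARGET OF RECORD: `CoreOffTubeFloor (63/10) (63/10) (24/5) (1/100) 0` **[CORE-FAR]** (no residual: the soft band is vacuous at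
`η₂ = 1/8`, `softFarFloor_eighth`).  Critic ROW 1078 (2)+(5): pin the bending class `𝓑`, the centre level `η₃` and the tolerance `τ`; state the
host-parameter BOX; and say how the host certificate (AH) is certified over that box — hosts are a continuum, so «one sparse PD test + one linear solve
per host» must become an interval statement over host-parameter CELLS, with the cell census (memo NODE-g61 §2, `census61.json`).

§0 THE TUBE FORM.  `TubeFloor 𝓘 τ` («every admissible clean mono-phase record cluster `τ`-charted by an instance of `𝓘` scores `≥ 0`») is EQUIVALENT to
g60's pair (AE) ∧ (AH) up to presentation: `FamilyEnvelope 𝓘 τ Φ` and the host inequality `Φ(z₀)(τ) ≤ S(z₀)` give it (`tubeFloor_of_envelope_of_hostCert`),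
and it gives them back with the tautological modulus `Φ_S(z₀)(t) := S(z₀)` (`envelope_of_tubeFloor`, `hostCert_of_tubeFloor`); the tables `P, R, G` of 60A
are the census's way of CERTIFYING the tube floor, not part of its statement.  With g60's pure cover `FamilyCover 𝓘 ρ ε η₂ τ` (copied verbatim, §0):
`TubeFloor 𝓘 τ → FamilyCover 𝓘 ρ ε (1/8) τ → CoreOffTubeFloor (63/10) (63/10) ρ ε 0` (`coreOff_of_tubeFloor_of_cover_eighth`), threaded to `StrainedPatchRec`.

§1 BOND CHARTS AND THE CELL LEMMA (the finite range).  The certificate of 60A sees a charted cluster only through PAIR DISTANCES (1-D bond floors over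
`|Δ_p| ≤ δ_p`), so the right cell currency is bond length, not position: `BondChart τ κ lam z c z₁ c₁ e'` charts the cluster by a REFERENCE instance with
pair tolerance `2τ + κ·d_ref(a,b) + lam·(d_ref(a,c₁)² + d_ref(b,c₁)²)` (texture + relative strain offset + bend offset), injective on the `63/10`-ball and
covering the reference's `6`-ball; `NearRef z₁ c₁ κ lam τ` is the family of instances so related to the reference on their `(63/10 + τ)`-ball;
`FatTubeFloor z₁ c₁ τ κ lam` is the tube floor AT ONE REFERENCE in bond currency.  ★ `bondChart_of_chartBy_of_nearRef` (`chartBy_bond`: the `2τ` triangle inequality): a position chart (`ChartBy`, coarse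
`τ`) by an instance that is `(κ, lam)`-near a reference composes to a bond chart by the reference — hence
★★ `tubeFloor_cell`: ONE fat-tube certificate at the reference decides the tube floor over the whole cell `𝓘 ⊓ NearRef z₁ c₁ κ lam τ`, and
★★ `tubeFloor_of_net_of_remainder`: for a finite reference net `N : RefNet K`, `NetCert N τ κ lam` (the `K` fat-tube certificates) and the tube floor over the
un-netted REMAINDER `𝓘 ⊓ ¬InNet N κ lam τ` give `TubeFloor 𝓘 τ`; `tubeFloor_of_net_of_isNet` when the net reaches the whole family.

§2 THE PINS (memo §1): `𝓑ᴾ := bends0 = polyBends (1/200) (1/2000)` (the tree's class of record, `…ChartFamiliesPinned` §1), `η₃ᴾ := 1/8` (forced: every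
far-class centre is `1/8`-good), family `FamP := bentFamilyW bends0 (1/8)` (the WINDOW-HONEST bent family of `…WindowFamilies` — a genuinely bent instance
violates `Admissible`'s radius clause, the g54 rim crack, so `bentFamily` would make the cover nearly hom-only), `τᴾ := 1/80`.  Pieces of record:
(BC)ᴾ `CoverP := FamilyCover FamP (24/5) (1/100) (1/8) (1/80)` [GEOMETRIC · UNDECIDED · INSTRUMENTABLE ← COVER-60 at degree ≤ 3 inside `bends0`'s bounds] and
(TF)ᴾ `TubeP := TubeFloor FamP (1/80)` [CERTIFICATE], with `TubeP → CoverP → [CORE-FAR]` (`coreOff_record_of_tubeP_of_coverP`).  THE BOX AND ITS CELLS (memo §2):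
(TF)ᴾ ⟸ `NetCert N (1/80) κ lam` [FINITE RANGE: `K` fat-tube certificates at reference HOMOGENEOUS hosts on a strain grid — census: `K ≈ 1.0·10⁷` at cell
half-width `w = 3·10⁻³`, `≈ 1.1·10⁸` at `w = 2·10⁻³` (fcc + hcp, mod point group, energetic dilation range), `w = (δ_cert − 2τ)/(5/2)` fixed by the AUG column
`δ_cert`] ∧ `RemainderP N κ lam` [ASYMPTOTIC REGIME: the tube floor over the STRONGLY BENT instances the net does not reach (`q₂ ≳ 10⁻³`): not cellable
(`≥ 10¹⁴` bend cells), UNDECIDED · INSTRUMENTABLE ← BEND-61 · IDEA-NEEDED (bend dominance)] (`tubeP_of_netCert_of_remainder`, `coreOff_record_of_cells`).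
Lean fixes no census number; no sorry, no new axioms, no cite tokens, no instances / notation / options.
-/

namespace Summit.AtomisticToContinuum.Crystallization.Theorems.FrustratedLawDichotomyStrainedPatchHostCells

open scoped BigOperators Classical
open Summit.AtomisticToContinuum.Crystallization.Theorems.FrustratedLawDichotomyPeriodicBlockFlags (goodAtScale_mono)
open Summit.AtomisticToContinuum.Crystallization.Theorems.FrustratedLawDichotomyRangeCut (Sep)
open Summit.AtomisticToContinuum.Crystallization.Theorems.FrustratedLawDichotomyMotifLemmas
open Summit.AtomisticToContinuum.Crystallization.Theorems.FrustratedLawDichotomyAveragingCut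
open Summit.AtomisticToContinuum.Crystallization.Theorems.FrustratedLawDichotomyAveragingRuleCap
open Summit.AtomisticToContinuum.Crystallization.Theorems.FrustratedLawDichotomyAveragingRuleTightFree
open Summit.AtomisticToContinuum.Crystallization.Theorems.FrustratedLawDichotomyExemptDoor (SitePred)
open Summit.AtomisticToContinuum.Crystallization.Theorems.FrustratedLawDichotomyExemptAbsorption
open Summit.AtomisticToContinuum.Crystallization.Theorems.FrustratedLawDichotomyExemptAbsorptionRecord
open Summit.AtomisticToContinuum.Crystallization.Theorems.FrustratedLawDichotomyCollarCensus
open Summit.AtomisticToContinuum.Crystallization.Theorems.FrustratedLawDichotomyCollarCensusKappa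
open Summit.AtomisticToContinuum.Crystallization.Theorems.FrustratedLawDichotomyStrainedPatchHomSplit
open Summit.AtomisticToContinuum.Crystallization.Theorems.FrustratedLawDichotomyStrainedPatchCleanCollar
open Summit.AtomisticToContinuum.Crystallization.Theorems.FrustratedLawDichotomyStrainedPatchHomTube
open Summit.AtomisticToContinuum.Crystallization.Theorems.FrustratedLawDichotomyStrainedPatchHomIsometry
open Summit.AtomisticToContinuum.Crystallization.Theorems.FrustratedLawDichotomyStrainedPatchHomTubeIso
open Summit.AtomisticToContinuum.Crystallization.Theorems.FrustratedLawDichotomyStrainedPatchPhaseCut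
open Summit.AtomisticToContinuum.Crystallization.Theorems.FrustratedLawDichotomyStrainedPatchCoreTube
open Summit.AtomisticToContinuum.Crystallization.Theorems.FrustratedLawDichotomyStrainedPatchCoreTubeRecord
open Summit.AtomisticToContinuum.Crystallization.Theorems.FrustratedLawDichotomyStrainedPatchCoreTubeMilli
open Summit.AtomisticToContinuum.Crystallization.Theorems.FrustratedLawDichotomyStrainedPatchStrainBands
open Summit.AtomisticToContinuum.Crystallization.Theorems.FrustratedLawDichotomyStrainedPatchChartFamilies
open Summit.AtomisticToContinuum.Crystallization.Theorems.FrustratedLawDichotomyStrainedPatchChartFamiliesBent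
open Summit.AtomisticToContinuum.Crystallization.Theorems.FrustratedLawDichotomyStrainedPatchChartFamiliesPinned
open Summit.AtomisticToContinuum.Crystallization.Theorems.FrustratedLawDichotomyStrainedPatchWindowFamilies

/-! ## §0. The tube form of (AE) ∧ (AH), the pure cover, and the junction to [CORE-FAR] -/

/-- **(TF) `TubeFloor 𝓘 τ`** — every admissible, `63/10`-clean, `63/10`-mono-phase record cluster that is `τ`-charted (coarse = fine = `τ`) by an
instance of the chart family `𝓘` scores `≥ 0`. -/
def TubeFloor (𝓘 : (M₀ : ℕ) → (Fin M₀ → E3) → Fin M₀ → Prop) (τ : ℝ) : Prop :=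
  ∀ (M : ℕ) (z : Fin M → E3) (c : Fin M) (M₀ : ℕ) (z₀ : Fin M₀ → E3) (c₀ : Fin M₀) (e : Fin M → Fin M₀),
    Admissible M z c → CleanBall (63 / 10) z c → MonoPhaseBall (63 / 10) z c → ChartBy 𝓘 τ τ z c z₀ c₀ e →
      0 ≤ ballAvg (9 / 5) z (xRec M z) c

/-- **`FamilyCover 𝓘 ρ ε η₂ τ` [GEOMETRIC — the COVER]** (g60, verbatim) — every far-class record cluster with an `η₂`-good centre is, modulo a linear
isometry, charted by an instance of the family with coarse AND fine deviation `τ` on the `63/10`-ball. -/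
def FamilyCover (𝓘 : (M₀ : ℕ) → (Fin M₀ → E3) → Fin M₀ → Prop) (ρ ε η₂ τ : ℝ) : Prop :=
  ∀ (M : ℕ) (z : Fin M → E3) (c : Fin M), Admissible M z c → CleanBall (63 / 10) z c → MonoPhaseBall (63 / 10) z c → ¬NearHomIsoAt ρ ε z c →
    GoodAtScale η₂ (3 / 2) z c →
      ∃ (R : E3 ≃ₗᵢ[ℝ] E3) (M₀ : ℕ) (z₀ : Fin M₀ → E3) (c₀ : Fin M₀) (e : Fin M → Fin M₀), ChartBy 𝓘 τ τ (⇑R ∘ z) c z₀ c₀ e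

/-- A chart with ANY fine deviation is a chart with fine deviation `τ` (the coarse clause already bounds the uncapped sites). [formal bookkeeping] -/
theorem chartBy_fine_self {𝓘 : (M₀ : ℕ) → (Fin M₀ → E3) → Fin M₀ → Prop} {τ t : ℝ} {M : ℕ} {z : Fin M → E3} {c : Fin M} {M₀ : ℕ}
    {z₀ : Fin M₀ → E3} {c₀ : Fin M₀} {e : Fin M → Fin M₀} (h : ChartBy 𝓘 τ t z c z₀ c₀ e) : ChartBy 𝓘 τ τ z c z₀ c₀ e :=
  ⟨h.1, h.2.1, h.2.2.1, fun a ha _ => h.2.2.1 a ha, h.2.2.2.2⟩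

/-- ★ (AE) ∧ (AH) ⟹ (TF): an envelope `S(z) ≥ S(z₀) − Φ(z₀)(t)` and the host inequality `Φ(z₀)(τ) ≤ S(z₀)` on the family give the tube floor. [folklore] -/
theorem tubeFloor_of_envelope_of_hostCert {𝓘 : (M₀ : ℕ) → (Fin M₀ → E3) → Fin M₀ → Prop} {τ : ℝ}
    {Φ : (M₀ : ℕ) → (Fin M₀ → E3) → Fin M₀ → ℝ → ℝ} (hτ : 0 ≤ τ) (hE : FamilyEnvelope 𝓘 τ Φ)
    (hH : ∀ (M₀ : ℕ) (z₀ : Fin M₀ → E3) (c₀ : Fin M₀), 𝓘 M₀ z₀ c₀ → Φ M₀ z₀ c₀ τ ≤ ballAvg (9 / 5) z₀ (xRec M₀ z₀) c₀) :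
    TubeFloor 𝓘 τ := by
  intro M z c M₀ z₀ c₀ e hz hcl hm hch
  have h₁ := hE M z c M₀ z₀ c₀ e τ hz hcl hm hτ hch
  have h₂ := hH M₀ z₀ c₀ hch.1
  linarith

/-- … in particular from g51's (F1) ∧ (F3) at the constant law `τ` and floor `0`. [formal bookkeeping] -/
theorem tubeFloor_of_envelope_of_cert {𝓘 : (M₀ : ℕ) → (Fin M₀ → E3) → Fin M₀ → Prop} {τ : ℝ}
    {Φ : (M₀ : ℕ) → (Fin M₀ → E3) → Fin M₀ → ℝ → ℝ} (hτ : 0 ≤ τ) (hE : FamilyEnvelope 𝓘 τ Φ) (hC : FamilyCert 𝓘 0 Φ (fun _ _ _ => τ)) :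
    TubeFloor 𝓘 τ :=
  tubeFloor_of_envelope_of_hostCert hτ hE fun M₀ z₀ c₀ hI => by have := hC M₀ z₀ c₀ hI; linarith

/-- ★ (TF) ⟹ (AE) with the tautological modulus `Φ_S(z₀)(t) := S(z₀)` … [formal bookkeeping] -/
theorem envelope_of_tubeFloor {𝓘 : (M₀ : ℕ) → (Fin M₀ → E3) → Fin M₀ → Prop} {τ : ℝ} (hT : TubeFloor 𝓘 τ) :
    FamilyEnvelope 𝓘 τ (fun M₀ z₀ c₀ _ => ballAvg (9 / 5) z₀ (xRec M₀ z₀) c₀) := by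
  intro M z c M₀ z₀ c₀ e t hz hcl hm _ hch
  have h₁ := hT M z c M₀ z₀ c₀ e hz hcl hm (chartBy_fine_self hch)
  linarith

/-- … and ⟹ (AH) for that modulus (trivially), so (TF) ⟺ ∃ Φ, (AE) ∧ (AH). [formal bookkeeping] -/
theorem hostCert_of_tubeFloor (𝓘 : (M₀ : ℕ) → (Fin M₀ → E3) → Fin M₀ → Prop) (τ : ℝ) :
    FamilyCert 𝓘 0 (fun M₀ z₀ c₀ _ => ballAvg (9 / 5) z₀ (xRec M₀ z₀) c₀) (fun _ _ _ => τ) :=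
  fun _ _ _ _ => by linarith

/-- `tubeFloor_iff_exists_envelope` (docstring added by the landing lane; see the module docstring). [formal bookkeeping] -/
theorem tubeFloor_iff_exists_envelope {𝓘 : (M₀ : ℕ) → (Fin M₀ → E3) → Fin M₀ → Prop} {τ : ℝ} (hτ : 0 ≤ τ) :
    TubeFloor 𝓘 τ ↔ ∃ Φ : (M₀ : ℕ) → (Fin M₀ → E3) → Fin M₀ → ℝ → ℝ, FamilyEnvelope 𝓘 τ Φ ∧ FamilyCert 𝓘 0 Φ (fun _ _ _ => τ) :=
  ⟨fun hT => ⟨_, envelope_of_tubeFloor hT, hostCert_of_tubeFloor 𝓘 τ⟩, fun ⟨_, hE, hC⟩ => tubeFloor_of_envelope_of_cert hτ hE hC⟩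

/-- ★★ THE JUNCTION: (TF) ∧ (cover) ⟹ `EdgeFarFloor (63/10) (63/10) ρ ε η₂ 0` — chart the rotated cluster, apply the tube floor, the score is
isometry-invariant. [folklore] -/
theorem edgeFar_of_tubeFloor_of_cover {𝓘 : (M₀ : ℕ) → (Fin M₀ → E3) → Fin M₀ → Prop} {ρ ε η₂ τ : ℝ} (hT : TubeFloor 𝓘 τ)
    (hC : FamilyCover 𝓘 ρ ε η₂ τ) : EdgeFarFloor (63 / 10) (63 / 10) ρ ε η₂ 0 := by
  intro M z c hz hcl hm hn hg
  obtain ⟨R, M₀, z₀, c₀, e, hch⟩ := hC M z c hz hcl hm hn hg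
  have h₁ := hT M (⇑R ∘ z) c M₀ z₀ c₀ e ((admissible_comp_iff R z c).2 hz) ((cleanBall_comp_iff R z c).2 hcl)
    ((monoPhaseBall_comp_iff R z c).2 hm) hch
  rwa [ballAvg_xRec_comp] at h₁

/-- ★★ … and at `η₂ = 1/8` the soft band is vacuous: (TF) ∧ (cover) ⟹ `CoreOffTubeFloor (63/10) (63/10) ρ ε 0`. [folklore] -/
theorem coreOff_of_tubeFloor_of_cover_eighth {𝓘 : (M₀ : ℕ) → (Fin M₀ → E3) → Fin M₀ → Prop} {ρ ε τ : ℝ} (hT : TubeFloor 𝓘 τ)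
    (hC : FamilyCover 𝓘 ρ ε (1 / 8) τ) : CoreOffTubeFloor (63 / 10) (63 / 10) ρ ε 0 :=
  (coreOff_iff_edge_and_soft _ _ ρ ε (1 / 8) 0).2 ⟨edgeFar_of_tubeFloor_of_cover hT hC, softFarFloor_eighth (by norm_num) _ _ _ _⟩

/-- The tube floor is ANTITONE in the family, the cover MONOTONE (the engine's trade). [formal bookkeeping] -/
theorem TubeFloor.anti_family {𝓘 𝓘' : (M₀ : ℕ) → (Fin M₀ → E3) → Fin M₀ → Prop} (hle : FamilyLE 𝓘 𝓘') {τ : ℝ} (h : TubeFloor 𝓘' τ) :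
    TubeFloor 𝓘 τ :=
  fun M z c M₀ z₀ c₀ e hz hcl hm hch => h M z c M₀ z₀ c₀ e hz hcl hm (hch.mono_family hle)

/-- `FamilyCover.mono_family` (docstring added by the landing lane; see the module docstring). [formal bookkeeping] -/
theorem FamilyCover.mono_family {𝓘 𝓘' : (M₀ : ℕ) → (Fin M₀ → E3) → Fin M₀ → Prop} (hle : FamilyLE 𝓘 𝓘') {ρ ε η₂ τ : ℝ}
    (h : FamilyCover 𝓘 ρ ε η₂ τ) : FamilyCover 𝓘' ρ ε η₂ τ := by
  intro M z c hz hcl hm hn hg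
  obtain ⟨R, M₀, z₀, c₀, e, hch⟩ := h M z c hz hcl hm hn hg
  exact ⟨R, M₀, z₀, c₀, e, hch.mono_family hle⟩

/-! ## §1. Bond charts, the cell lemma and the finite host net -/

/-- The `2τ` triangle inequality: sites charted within `τ` (positions relative to the centres) have pair distances within `2τ`. [folklore] -/
theorem bond_dev_le {u v w u₀ v₀ w₀ : E3} {τ : ℝ} (ha : dist (u - w) (u₀ - w₀) ≤ τ) (hb : dist (v - w) (v₀ - w₀) ≤ τ) :
    |dist u v - dist u₀ v₀| ≤ 2 * τ := by
  rw [dist_eq_norm] at ha hb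
  rw [dist_eq_norm, dist_eq_norm]
  have key : u - v - (u₀ - v₀) = (u - w - (u₀ - w₀)) - (v - w - (v₀ - w₀)) := by abel
  calc |‖u - v‖ - ‖u₀ - v₀‖| ≤ ‖u - v - (u₀ - v₀)‖ := abs_norm_sub_norm_le _ _
    _ = ‖(u - w - (u₀ - w₀)) - (v - w - (v₀ - w₀))‖ := by rw [key]
    _ ≤ ‖u - w - (u₀ - w₀)‖ + ‖v - w - (v₀ - w₀)‖ := norm_sub_le _ _
    _ ≤ 2 * τ := by linarith

/-- A charted ball site's label lies in the instance's `(63/10 + τ)`-ball. [formal bookkeeping] -/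
theorem inst_dist_le {u u₀ : E3} {τ r : ℝ} (hu : ‖u‖ ≤ r) (h : dist u u₀ ≤ τ) : ‖u₀‖ ≤ r + τ := by
  rw [dist_eq_norm] at h
  calc ‖u₀‖ = ‖u - (u - u₀)‖ := by rw [sub_sub_cancel]
    _ ≤ ‖u‖ + ‖u - u₀‖ := norm_sub_le _ _
    _ ≤ r + τ := add_le_add hu h

/-- Pair deviation `≤ 2τ` on the charted ball. [folklore] -/
theorem chartBy_bond {𝓘 : (M₀ : ℕ) → (Fin M₀ → E3) → Fin M₀ → Prop} {τ t : ℝ} {M : ℕ} {z : Fin M → E3} {c : Fin M} {M₀ : ℕ}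
    {z₀ : Fin M₀ → E3} {c₀ : Fin M₀} {e : Fin M → Fin M₀} (h : ChartBy 𝓘 τ t z c z₀ c₀ e) {a b : Fin M}
    (ha : dist (z a) (z c) ≤ 63 / 10) (hb : dist (z b) (z c) ≤ 63 / 10) :
    |dist (z a) (z b) - dist (z₀ (e a)) (z₀ (e b))| ≤ 2 * τ :=
  bond_dev_le (h.2.2.1 a ha) (h.2.2.1 b hb)

/-- Labels of ball sites lie in the instance's `(63/10 + τ)`-ball. [formal bookkeeping] -/
theorem chartBy_inst_ball {𝓘 : (M₀ : ℕ) → (Fin M₀ → E3) → Fin M₀ → Prop} {τ t : ℝ} {M : ℕ} {z : Fin M → E3} {c : Fin M} {M₀ : ℕ}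
    {z₀ : Fin M₀ → E3} {c₀ : Fin M₀} {e : Fin M → Fin M₀} (h : ChartBy 𝓘 τ t z c z₀ c₀ e) {a : Fin M}
    (ha : dist (z a) (z c) ≤ 63 / 10) : dist (z₀ (e a)) (z₀ c₀) ≤ 63 / 10 + τ := by
  have h₁ := h.2.2.1 a ha
  rw [dist_eq_norm] at ha ⊢
  exact inst_dist_le ha h₁

/-- **`NearRef z₁ c₁ κ lam τ`** — the family of instances `(h, c₀)` that are `(κ, lam)`-NEAR THE REFERENCE `(z₁, c₁)` in bond currency: a labelling
`f` into the reference, centre to centre, with pair tolerance `κ·d_ref(a,b) + lam·(d_ref(a,c₁)² + d_ref(b,c₁)²)` on the instance's `(63/10 + τ)`-ball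
(relative STRAIN offset `κ` — two homogeneous hosts whose strains differ by `κ` in operator norm — plus BEND offset `lam = q₂ + 8 q₃` — a `polyBends q₂ q₃`
image of the reference skeleton), injective there, and covering the reference's `6`-ball by the instance's `(63/10 − τ)`-ball. A CELL of the host box. -/
def NearRef {M₁ : ℕ} (z₁ : Fin M₁ → E3) (c₁ : Fin M₁) (κ lam τ : ℝ) : (M₀ : ℕ) → (Fin M₀ → E3) → Fin M₀ → Prop :=
  fun M₀ h c₀ => ∃ f : Fin M₀ → Fin M₁, f c₀ = c₁ ∧
    (∀ a b, dist (h a) (h c₀) ≤ 63 / 10 + τ → dist (h b) (h c₀) ≤ 63 / 10 + τ →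
      |dist (h a) (h b) - dist (z₁ (f a)) (z₁ (f b))| ≤
        κ * dist (z₁ (f a)) (z₁ (f b)) + lam * (dist (z₁ (f a)) (z₁ c₁) ^ 2 + dist (z₁ (f b)) (z₁ c₁) ^ 2)) ∧
    (∀ a b, dist (h a) (h c₀) ≤ 63 / 10 + τ → dist (h b) (h c₀) ≤ 63 / 10 + τ → f a = f b → a = b) ∧
    (∀ b₁, dist (z₁ b₁) (z₁ c₁) ≤ 6 → ∃ a, dist (h a) (h c₀) ≤ 63 / 10 - τ ∧ f a = b₁)

/-- **`BondChart τ κ lam z c z₁ c₁ e'`** — the cluster `(z, c)` charted by the REFERENCE `(z₁, c₁)` in BOND currency: centre to centre, pair tolerance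
`2τ + κ·d_ref + lam·(d_ref(·,c₁)² + d_ref(·,c₁)²)` on the `63/10`-ball, injective there, covering the reference's `6`-ball.  Isometry-invariant (no rotation). -/
def BondChart (τ κ lam : ℝ) {M : ℕ} (z : Fin M → E3) (c : Fin M) {M₁ : ℕ} (z₁ : Fin M₁ → E3) (c₁ : Fin M₁) (e' : Fin M → Fin M₁) : Prop :=
  e' c = c₁ ∧
    (∀ a b, dist (z a) (z c) ≤ 63 / 10 → dist (z b) (z c) ≤ 63 / 10 →
      |dist (z a) (z b) - dist (z₁ (e' a)) (z₁ (e' b))| ≤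
        2 * τ + κ * dist (z₁ (e' a)) (z₁ (e' b)) + lam * (dist (z₁ (e' a)) (z₁ c₁) ^ 2 + dist (z₁ (e' b)) (z₁ c₁) ^ 2)) ∧
    (∀ a b, dist (z a) (z c) ≤ 63 / 10 → dist (z b) (z c) ≤ 63 / 10 → e' a = e' b → a = b) ∧
    (∀ b₁, dist (z₁ b₁) (z₁ c₁) ≤ 6 → ∃ a, dist (z a) (z c) ≤ 63 / 10 ∧ e' a = b₁)

/-- **(FT) `FatTubeFloor z₁ c₁ τ κ lam` [CERTIFICATE at ONE reference host, INSTRUMENTABLE]** — every admissible clean mono-phase record cluster bond-charted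
by the reference with tolerances `(2τ, κ, lam)` scores `≥ 0`.  Method (memo §2): the 60A certificate at `z₁` with SECANT 1-D floors over the fat bond
tubes `|Δ_p| ≤ 2τ + κ d_p + lam(|x_a|² + |x_b|²)` — one sparse PD test + one linear solve per reference. -/
def FatTubeFloor {M₁ : ℕ} (z₁ : Fin M₁ → E3) (c₁ : Fin M₁) (τ κ lam : ℝ) : Prop :=
  ∀ (M : ℕ) (z : Fin M → E3) (c : Fin M) (e' : Fin M → Fin M₁), Admissible M z c → CleanBall (63 / 10) z c → MonoPhaseBall (63 / 10) z c →
    BondChart τ κ lam z c z₁ c₁ e' → 0 ≤ ballAvg (9 / 5) z (xRec M z) c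

/-- ★ THE COMPOSITION: a position chart by an instance near the reference is a bond chart by the reference. [folklore] -/
theorem bondChart_of_chartBy_of_nearRef {𝓘 : (M₀ : ℕ) → (Fin M₀ → E3) → Fin M₀ → Prop} {τ t : ℝ} {M : ℕ} {z : Fin M → E3} {c : Fin M}
    {M₀ : ℕ} {h : Fin M₀ → E3} {c₀ : Fin M₀} {e : Fin M → Fin M₀} (hch : ChartBy 𝓘 τ t z c h c₀ e) {M₁ : ℕ} {z₁ : Fin M₁ → E3} {c₁ : Fin M₁}
    {κ lam : ℝ} (hn : NearRef z₁ c₁ κ lam τ M₀ h c₀) : ∃ e' : Fin M → Fin M₁, BondChart τ κ lam z c z₁ c₁ e' := by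
  obtain ⟨f, hfc, hdev, hinj, hcov⟩ := hn
  refine ⟨fun a => f (e a), ?_, fun a b ha hb => ?_, fun a b ha hb hab => ?_, fun b₁ hb₁ => ?_⟩
  · show f (e c) = c₁
    rw [hch.2.1, hfc]
  · have h₁ := chartBy_bond hch ha hb
    have h₂ := hdev (e a) (e b) (chartBy_inst_ball hch ha) (chartBy_inst_ball hch hb)
    have h₃ := abs_sub_le (dist (z a) (z b)) (dist (h (e a)) (h (e b))) (dist (z₁ (f (e a))) (z₁ (f (e b))))
    linarith
  · exact hch.2.2.2.2.1 a b ha hb (hinj (e a) (e b) (chartBy_inst_ball hch ha) (chartBy_inst_ball hch hb) hab)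
  · obtain ⟨a₀, ha₀, hfa₀⟩ := hcov b₁ hb₁
    obtain ⟨a, ha, hea⟩ := hch.2.2.2.2.2 a₀ ha₀
    exact ⟨a, ha, show f (e a) = b₁ by rw [hea, hfa₀]⟩

/-- ★★ THE CELL LEMMA: ONE fat-tube certificate at the reference decides the tube floor over the whole cell `𝓘 ⊓ NearRef z₁ c₁ κ lam τ`. [folklore] -/
theorem tubeFloor_cell {𝓘 : (M₀ : ℕ) → (Fin M₀ → E3) → Fin M₀ → Prop} {τ κ lam : ℝ} {M₁ : ℕ} {z₁ : Fin M₁ → E3} {c₁ : Fin M₁}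
    (hF : FatTubeFloor z₁ c₁ τ κ lam) : TubeFloor (fun M₀ h c₀ => 𝓘 M₀ h c₀ ∧ NearRef z₁ c₁ κ lam τ M₀ h c₀) τ := by
  intro M z c M₀ h c₀ e hz hcl hm hch
  obtain ⟨e', he'⟩ := bondChart_of_chartBy_of_nearRef hch hch.1.2
  exact hF M z c e' hz hcl hm he'

/-- **A finite REFERENCE NET**: `K` reference instances (index type, positions, centre). -/
structure RefNet (K : ℕ) where
  /-- number of sites of the `k`-th reference -/
  M : Fin K → ℕ
  /-- positions of the `k`-th reference -/
  z : (k : Fin K) → Fin (M k) → E3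
  /-- centre index of the `k`-th reference -/
  c : (k : Fin K) → Fin (M k)

/-- `InNet N κ lam τ` — the instances reached by the net: `(κ, lam)`-near SOME reference. -/
def InNet {K : ℕ} (N : RefNet K) (κ lam τ : ℝ) : (M₀ : ℕ) → (Fin M₀ → E3) → Fin M₀ → Prop :=
  fun M₀ h c₀ => ∃ k, NearRef (N.z k) (N.c k) κ lam τ M₀ h c₀

/-- **`NetCert N τ κ lam` [FINITE RANGE — `K` fat-tube certificates]**. -/
def NetCert {K : ℕ} (N : RefNet K) (τ κ lam : ℝ) : Prop := ∀ k, FatTubeFloor (N.z k) (N.c k) τ κ lam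

/-- The netted part of any family is decided by the `K` certificates. [folklore] -/
theorem tubeFloor_of_netCert {𝓘 : (M₀ : ℕ) → (Fin M₀ → E3) → Fin M₀ → Prop} {K : ℕ} {N : RefNet K} {τ κ lam : ℝ} (hcert : NetCert N τ κ lam) :
    TubeFloor (fun M₀ h c₀ => 𝓘 M₀ h c₀ ∧ InNet N κ lam τ M₀ h c₀) τ := by
  intro M z c M₀ h c₀ e hz hcl hm hch
  obtain ⟨k, hk⟩ := hch.1.2
  obtain ⟨e', he'⟩ := bondChart_of_chartBy_of_nearRef hch hk
  exact hcert k M z c e' hz hcl hm he'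

/-- Splitting a family by a predicate splits the tube floor. [formal bookkeeping] -/
theorem tubeFloor_split {𝓘 : (M₀ : ℕ) → (Fin M₀ → E3) → Fin M₀ → Prop} (P : (M₀ : ℕ) → (Fin M₀ → E3) → Fin M₀ → Prop) {τ : ℝ}
    (h₁ : TubeFloor (fun M₀ h c₀ => 𝓘 M₀ h c₀ ∧ P M₀ h c₀) τ) (h₂ : TubeFloor (fun M₀ h c₀ => 𝓘 M₀ h c₀ ∧ ¬P M₀ h c₀) τ) : TubeFloor 𝓘 τ := by
  intro M z c M₀ h c₀ e hz hcl hm hch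
  by_cases hP : P M₀ h c₀
  · exact h₁ M z c M₀ h c₀ e hz hcl hm ⟨⟨hch.1, hP⟩, hch.2⟩
  · exact h₂ M z c M₀ h c₀ e hz hcl hm ⟨⟨hch.1, hP⟩, hch.2⟩

/-- ★★ THE NET JUNCTION: `K` certificates ∧ the tube floor over the un-netted REMAINDER ⟹ the tube floor over the family. [folklore] -/
theorem tubeFloor_of_net_of_remainder {𝓘 : (M₀ : ℕ) → (Fin M₀ → E3) → Fin M₀ → Prop} {K : ℕ} {N : RefNet K} {τ κ lam : ℝ}
    (hcert : NetCert N τ κ lam) (hrem : TubeFloor (fun M₀ h c₀ => 𝓘 M₀ h c₀ ∧ ¬InNet N κ lam τ M₀ h c₀) τ) : TubeFloor 𝓘 τ :=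
  tubeFloor_split _ (tubeFloor_of_netCert hcert) hrem

/-- … and when the net reaches the whole family the remainder is empty. [folklore] -/
theorem tubeFloor_of_net_of_isNet {𝓘 : (M₀ : ℕ) → (Fin M₀ → E3) → Fin M₀ → Prop} {K : ℕ} {N : RefNet K} {τ κ lam : ℝ}
    (hcert : NetCert N τ κ lam) (hnet : FamilyLE 𝓘 (InNet N κ lam τ)) : TubeFloor 𝓘 τ :=
  tubeFloor_of_net_of_remainder hcert fun _ _ _ M₀ h c₀ _ _ _ _ hch => absurd (hnet M₀ h c₀ hch.1.1) hch.1.2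

/-- The fat-tube floor is ANTITONE in each tolerance (a fatter certificate decides more). [formal bookkeeping] -/
theorem FatTubeFloor.anti {M₁ : ℕ} {z₁ : Fin M₁ → E3} {c₁ : Fin M₁} {τ τ' κ κ' lam lam' : ℝ} (h : FatTubeFloor z₁ c₁ τ' κ' lam')
    (hτ : τ ≤ τ') (hκ : κ ≤ κ') (hl : lam ≤ lam') : FatTubeFloor z₁ c₁ τ κ lam := by
  intro M z c e' hz hcl hm hb
  refine h M z c e' hz hcl hm ⟨hb.1, fun a b ha hb' => (hb.2.1 a b ha hb').trans ?_, hb.2.2⟩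
  have h₁ : 0 ≤ dist (z₁ (e' a)) (z₁ (e' b)) := dist_nonneg
  have h₂ : 0 ≤ dist (z₁ (e' a)) (z₁ c₁) ^ 2 + dist (z₁ (e' b)) (z₁ c₁) ^ 2 := by positivity
  nlinarith [mul_le_mul_of_nonneg_right hκ h₁, mul_le_mul_of_nonneg_right hl h₂]

/-! ### Gentle bends sit inside the homogeneous cells -/

/-- The skeleton ball radius (as in `…WindowFamilies` §1). [formal bookkeeping] -/
theorem dist_le_of_isHomBall {R : ℝ} {M : ℕ} {z₀ : Fin M → E3} {c : Fin M} (hH : IsHomBall R z₀ c) (a : Fin M) : dist (z₀ a) (z₀ c) ≤ R := by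
  obtain ⟨G, ξ, -, -, hr⟩ := hH
  have hmem : z₀ a ∈ Set.range z₀ := ⟨a, rfl⟩
  rcases hr with hr | hr
  · rw [hr] at hmem; exact hmem.1
  · rw [hr] at hmem; exact hmem.1

/-- Pair deviation of a polynomial bend: `|d(bu, bv) − d(u, v)| ≤ q₂(‖u‖² + ‖v‖²) + q₃(‖u‖³ + ‖v‖³)`. [folklore] -/
theorem bend_pair_dev {q₂ q₃ : ℝ} {b : E3 → E3} (hb : b ∈ polyBends q₂ q₃) (u v : E3) :
    |dist (b u) (b v) - dist u v| ≤ q₂ * (‖u‖ ^ 2 + ‖v‖ ^ 2) + q₃ * (‖u‖ ^ 3 + ‖v‖ ^ 3) := by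
  rw [dist_eq_norm, dist_eq_norm]
  have key : b u - b v - (u - v) = (b u - u) - (b v - v) := by abel
  have h₁ := polyBends_disp hb u
  have h₂ := polyBends_disp hb v
  calc |‖b u - b v‖ - ‖u - v‖| ≤ ‖b u - b v - (u - v)‖ := abs_norm_sub_norm_le _ _
    _ = ‖(b u - u) - (b v - v)‖ := by rw [key]
    _ ≤ ‖b u - u‖ + ‖b v - v‖ := norm_sub_le _ _
    _ ≤ _ := by linarith

/-- ★ A `polyBends q₂ q₃`-bent `133/10`-ball is `(0, q₂ + (133/10)·q₃)`-NEAR ITS OWN SKELETON (labelling = identity), provided the bend keeps the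
skeleton's `6`-ball inside the `(63/10 − τ)`-ball (`36 q₂ + 216 q₃ + τ ≤ 3/10`).  So GENTLE bends sit inside the homogeneous references' fat tubes at bend
offset `lam = q₂ + 13.3 q₃`; what the net cannot absorb at the certificate's `lam`-budget is the REMAINDER of §2. [folklore] -/
theorem nearRef_skeleton_of_bent {q₂ q₃ τ : ℝ} (h₂ : 0 ≤ q₂) (h₃ : 0 ≤ q₃) (hcov : 36 * q₂ + 216 * q₃ + τ ≤ 3 / 10) {b : E3 → E3}
    (hb : b ∈ polyBends q₂ q₃) {M₀ : ℕ} {z₀ h : Fin M₀ → E3} {c₀ : Fin M₀} (hH : IsHomBall (133 / 10) z₀ c₀)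
    (hz : ∀ a, h a - h c₀ = b (z₀ a - z₀ c₀)) : NearRef z₀ c₀ 0 (q₂ + 133 / 10 * q₃) τ M₀ h c₀ := by
  refine ⟨id, rfl, fun a a' _ _ => ?_, fun a a' _ _ hab => hab, fun b₁ hb₁ => ⟨b₁, ?_, rfl⟩⟩
  · have hu : ‖z₀ a - z₀ c₀‖ ≤ 133 / 10 := by rw [← dist_eq_norm]; exact dist_le_of_isHomBall hH a
    have hv : ‖z₀ a' - z₀ c₀‖ ≤ 133 / 10 := by rw [← dist_eq_norm]; exact dist_le_of_isHomBall hH a'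
    have hd : dist (h a) (h a') = dist (b (z₀ a - z₀ c₀)) (b (z₀ a' - z₀ c₀)) := by
      rw [dist_eq_norm, dist_eq_norm, ← hz a, ← hz a']; congr 1; abel
    have hd₀ : dist (z₀ a) (z₀ a') = dist (z₀ a - z₀ c₀) (z₀ a' - z₀ c₀) := by
      rw [dist_eq_norm, dist_eq_norm]; congr 1; abel
    have hdev := bend_pair_dev hb (z₀ a - z₀ c₀) (z₀ a' - z₀ c₀)
    show |dist (h a) (h a') - dist (z₀ a) (z₀ a')| ≤
      0 * dist (z₀ a) (z₀ a') + (q₂ + 133 / 10 * q₃) * (dist (z₀ a) (z₀ c₀) ^ 2 + dist (z₀ a') (z₀ c₀) ^ 2)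
    rw [zero_mul, zero_add, hd, hd₀, dist_eq_norm (z₀ a) (z₀ c₀), dist_eq_norm (z₀ a') (z₀ c₀)]
    set nu := ‖z₀ a - z₀ c₀‖
    set nv := ‖z₀ a' - z₀ c₀‖
    have e₁ : q₃ * nu ^ 3 ≤ 133 / 10 * q₃ * nu ^ 2 := by
      nlinarith [mul_nonneg (mul_nonneg h₃ (sq_nonneg nu)) (sub_nonneg.2 hu)]
    have e₂ : q₃ * nv ^ 3 ≤ 133 / 10 * q₃ * nv ^ 2 := by
      nlinarith [mul_nonneg (mul_nonneg h₃ (sq_nonneg nv)) (sub_nonneg.2 hv)]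
    nlinarith [hdev, e₁, e₂]
  · have hu : ‖z₀ b₁ - z₀ c₀‖ ≤ 6 := by rwa [dist_eq_norm] at hb₁
    rw [dist_eq_norm, hz b₁]
    have hdisp := polyBends_disp hb (z₀ b₁ - z₀ c₀)
    set nu := ‖z₀ b₁ - z₀ c₀‖
    have hnu : 0 ≤ nu := norm_nonneg _
    have h1 : ‖b (z₀ b₁ - z₀ c₀)‖ ≤ nu + (q₂ * nu ^ 2 + q₃ * nu ^ 3) := by
      calc ‖b (z₀ b₁ - z₀ c₀)‖ = ‖(z₀ b₁ - z₀ c₀) + (b (z₀ b₁ - z₀ c₀) - (z₀ b₁ - z₀ c₀))‖ := by rw [add_sub_cancel]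
        _ ≤ nu + ‖b (z₀ b₁ - z₀ c₀) - (z₀ b₁ - z₀ c₀)‖ := norm_add_le _ _
        _ ≤ nu + (q₂ * nu ^ 2 + q₃ * nu ^ 3) := by linarith
    have hnu2 : nu ^ 2 ≤ 36 := by nlinarith
    have hnu3 : nu ^ 3 ≤ 216 := by nlinarith
    have e₂ := mul_le_mul_of_nonneg_left hnu2 h₂
    have e₃ := mul_le_mul_of_nonneg_left hnu3 h₃
    linarith

/-- … in particular a window-honest `polyBends q₂ q₃`-bent instance is in the `(0, q₂ + 13.3 q₃)`-cell of its skeleton. [formal bookkeeping] -/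
theorem nearRef_of_isBentBall {q₂ q₃ τ : ℝ} (h₂ : 0 ≤ q₂) (h₃ : 0 ≤ q₃) (hcov : 36 * q₂ + 216 * q₃ + τ ≤ 3 / 10) {M₀ : ℕ} {h : Fin M₀ → E3}
    {c₀ : Fin M₀} (hB : IsBentBall (polyBends q₂ q₃) (133 / 10) h c₀) :
    ∃ z₀ : Fin M₀ → E3, IsHomBall (133 / 10) z₀ c₀ ∧ NearRef z₀ c₀ 0 (q₂ + 133 / 10 * q₃) τ M₀ h c₀ := by
  obtain ⟨b, z₀, hb, hH, hz⟩ := hB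
  exact ⟨z₀, hH, nearRef_skeleton_of_bent h₂ h₃ hcov hb hH hz⟩

end Summit.AtomisticToContinuum.Crystallization.Theorems.FrustratedLawDichotomyStrainedPatchHostCells
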